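import Literature.NumberTheory.Automorphic.HLTTCompatible
import Literature.NumberTheory.GaloisRepresentations.ResidualGaloisRep
import Literature.NumberTheory.GaloisRepresentations.EnormousSubgroup
import Literature.NumberTheory.GaloisRepresentations.DecomposedGeneric
import Literature.NumberTheory.GaloisRepresentations.LabelledHodgeTateWeights
import Literature.NumberTheory.GaloisRepresentations.CrystallineDeformationRing
import Literature.NumberTheory.PAdicHodge.FontaineDpst
import HarnessLib

/-!
# ACC+ 2023, Thm. 6.1.1 (Fontaine–Laffaille automorphy lifting for `GL_n` over CM or totally real `F`), weight zero

Topic `NumberTheory/Automorphic` (vocabulary of `ReciprocityGLn` / `HLTTCompatible`: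
`CuspidalAutomorphicRepData`, `AutomorphicRepData.HasWeightZero`, `AutomorphicRepData.IsUnramifiedAt`,
`HLTT.IsCompatible` — the facts-free twin of `HarrisLanTaylorThorne2016.IsCompatible` of
`ReciprocityGLnProofs`, definitionally equal to it (`HarrisLanTaylorThorne2016.isCompatible_iff_hltt`,
`Iff.rfl`); since 2026-08-17 this file imports `HLTTCompatible` instead of `ReciprocityGLnProofs`,
so that its import cone no longer carries the three undischarged named facts
`HarrisLanTaylorThorne2016.theoremA_existence` / `theoremA_uniqueness` /
`Varma2024.corollary93_unramified`, which this fact never used (definition request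
`defn-HLTTCompatible` of route `StickelbergerDial`); the statement below is unchanged up to that
definitional unfolding —; of the Galois-representation files: `FramedGaloisRep`,
`IsUnramifiedAt`, `toLocal`, `labelledHodgeTateWeightsAt` (`LabelledHodgeTateWeights`),
`PstWeilDeligneData.IsCrystallineFramed` (`CrystallineDeformationRing`), the PINNED datum
`PAdicHodge.fontainePstAdicCompletion v p hv` (`FontaineDpst`), `IsResidualRepOf`, `IsAbsIrreducible`,
`padicAlgClResidueField` (`ResidualGaloisRep`), `Subgroup.IsEnormous` (`EnormousSubgroup`),
`IsDecomposedGeneric`, `absGaloisGroupAdjoinRootsOfUnity` (`DecomposedGeneric`)).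

P. B. Allen, F. Calegari, A. Caraiani, T. Gee, D. Helm, B. V. Le Hung, J. Newton, P. Scholze,
R. Taylor, J. A. Thorne, *Potential automorphy over CM fields*, Ann. of Math. (2) 197 (2023),
897–1113 (= arXiv:1812.09999), **Theorem 6.1.1** (§6.1 "Statements"), as printed (read
2026-08-16 from the held text `paper:arxiv-1812.09999`, p0064):

> Let `F` be an imaginary CM or totally real field, let `c ∈ Aut(F)` be complex conjugation,
> and let `p` be a prime. Suppose given a continuous representation `ρ : G_F → GL_n(ℚ̄_p)`
> satisfying the following conditions:
> (1) `ρ` is unramified almost everywhere.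
> (2) For each place `v | p` of `F`, the representation `ρ|_{G_{F_v}}` is crystalline. The
>     prime `p` is unramified in `F`.
> (3) `ρ̄` is absolutely irreducible and decomposed generic (Definition 4.3.1). The image of
>     `ρ̄|_{G_{F(ζ_p)}}` is enormous (Definition 6.2.28).
> (4) There exists `σ ∈ G_F − G_{F(ζ_p)}` such that `ρ̄(σ)` is a scalar. We have `p > n²`.
> (5) There exists a cuspidal automorphic representation `π` of `GL_n(𝔸_F)` satisfying the
>     following conditions:
>     (a) `π` is regular algebraic of weight `λ`, this weight satisfying
>         `λ_{τ,1} + λ_{τc,1} − λ_{τ,n} − λ_{τc,n} < p − 2n` for all `τ`.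
>     (b) There exists an isomorphism `ι : ℚ̄_p → ℂ` such that `ρ̄ ≅ \overline{r_ι(π)}` and the
>         Hodge–Tate weights of `ρ` satisfy the formula for each `τ : F ↪ ℚ̄_p`:
>         `HT_τ(ρ) = {λ_{ιτ,1} + n − 1, λ_{ιτ,2} + n − 2, …, λ_{ιτ,n}}`.
>     (c) If `v | p` is a place of `F`, then `π_v` is unramified.
> Then `ρ` is automorphic: there exists a cuspidal automorphic representation `Π` of `GL_n(𝔸_F)`
> of weight `λ` such that `ρ ≅ r_ι(Π)`. Moreover, if `v` is a finite place of `F` and either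
> `v | p` or both `ρ` and `π` are unramified at `v`, then `Π_v` is unramified.

None of this (Calegari–Geraghty patching in positive defect with the torsion local–global
compatibility of §§3–5) is within reach of the library: NAMED FACT (D-0014).  Requested by route
`RamifiedCoefficientSeed` (summit `Langlands`, item `AdjointLiftingGL3`, `F = ℚ`, `n = 3`,
Hodge–Tate weights `{0, 1, 2}`); the theorem is also the engine cited by a dozen other open
`Langlands` routes (grep `Thm 6.1.1` in `Summits/Langlands/Langlands/Theses`), and the accepted
`ReciprocityGLn.lean` records it as "not covered".

## What is vendored: the WEIGHT-ZERO member (`λ = 0`)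

The tree types "`π` is regular algebraic of weight `λ`" only for `λ = 0`
(`AutomorphicRepData.HasWeightZero`: `π_∞` has the infinitesimal character of the trivial
representation — ACC+'s "weight `0`", Clozel's cohomological-for-trivial-coefficients), so the
fact below is Theorem 6.1.1 SPECIALISED to `λ = 0`, where (5a) reads `0 < p − 2n` and (5b) reads
`HT_τ(ρ) = {n − 1, n − 2, …, 0}` for every `τ`.  This is a faithful instance (weaker than the
printed theorem, never stronger); the general-weight statement awaits a `HasWeight λ` predicate.

## Rendering, clause by clause

* `F` imaginary CM or totally real: `IsTotallyReal F ∨ IsCMField F` (Mathlib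
  `NumberField.IsCMField` = totally complex quadratic extension of the maximal real subfield, i.e.
  ACC+'s "imaginary CM"), the disjunction of the accepted `exists_galoisRep_of_regularAlgebraic`.
* (1) `∀ᶠ v in cofinite, ρ.IsUnramifiedAt v`.
* (2) for every `v ∣ p`: `(fontainePstAdicCompletion v p hv).IsCrystallineFramed (ρ.toLocal v)` —
  crystalline relative to THE pinned Fontaine datum of `F_v` (de Rham, `N = 0`, `WD` unramified),
  the summit's phrasing; `p` unramified in `F`: Mathlib `Algebra.IsUnramifiedIn (𝓞 F) (p)`.
* (3)–(4) exactly as in the accepted `Qian2022.potentialAutomorphy_ordinary`: for SOME residual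
  representation `τ : Γ_F → GL_n(ℤ̄_p/𝔪)` of `ρ` (`IsResidualRepOf`; `ρ̄` is only defined up to
  conjugacy and every condition is conjugation-invariant, so "some" is the printed hypothesis):
  `τ` absolutely irreducible, decomposed generic, `τ|_{Γ_{F(ζ_p)}}` absolutely irreducible with
  enormous image (Def. 6.2.28 predicates "enormous" of an absolutely irreducible subgroup;
  `Subgroup.IsEnormous` does not include absolute irreducibility, hence both conjuncts), and
  `τ σ` scalar for some `σ ∉ Γ_{F(ζ_p)}`; `n² < p`.
* (5) `π : CuspidalAutomorphicRepData n F hcpt` with (a) `π.1.HasWeightZero` and `2n < p`;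
  (b) "`ρ̄ ≅ \overline{r_ι(π)}`" rendered WITHOUT a function `π ↦ r_ι(π)` (the tree has HLTT
  Thm. A only as the existence fact `exists_galoisRep_of_regularAlgebraic`): there is a framed
  `r : Γ_F → GL_n(ℚ̄_p)` having HLTT's characterising property of `r_ι(π)`
  (`HLTT.IsCompatible π ι r`: unramified with the predicted characteristic
  polynomial of Frobenius at every place over every rational prime `q ≠ p` above which `π` is
  unramified) whose residual representation is the same `τ`.  By Chebotarev and Brauer–Nesbitt
  such an `r` has `r^{ss} ≅ r_ι(π)`, hence `r̄ = \overline{r_ι(π)}`, so this is EQUIVALENT to the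
  printed hypothesis (and `r := r_ι(π)` witnesses it); the Hodge–Tate clause is
  `ρ.labelledHodgeTateWeightsAt v D.algebra D.𝔅 τ' = {0, 1, …, n − 1}` for every `v ∣ p` and
  every `ℚ_p`-embedding `τ' : F_v → ℚ̄_p` (embeddings `F ↪ ℚ̄_p` = pairs `(v, τ')`), relative to
  the pinned datum `D = fontainePstAdicCompletion v p hv` (its `ℚ_p`-structure `D.algebra` and
  period ring `D.𝔅`, intended `B_dR(F_v)`; convention `HT(ε_p) = {−1}` as in ACC+ §1);
  (c) `π.1.IsUnramifiedAt v` for `v ∣ p`.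
* Conclusion "`ρ ≅ r_ι(Π)`, `Π` cuspidal of weight `λ = 0`": `∃ Π : CuspidalAutomorphicRepData n F hcpt`
  with `Π.1.HasWeightZero` and `HLTT.IsCompatible Π.1 ι ρ` (the property
  characterising `r_ι(Π)`, which `ρ ≅ r_ι(Π)` implies since it is isomorphism-invariant), plus the
  two unramifiedness clauses for `Π_v`.  (For `n` odd, weight `0` is both C- and L-algebraic; a
  consumer wanting the summit's L-normalised `SatakeFrobCompatibleAt ι Π ρ v` twists by
  `|det|^{(n-1)/2}`.)

## References

* [ACCGHLNSTT2023] P. B. Allen, F. Calegari, A. Caraiani, T. Gee, D. Helm, B. V. Le Hung,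
  J. Newton, P. Scholze, R. Taylor, J. A. Thorne, *Potential automorphy over CM fields*, Ann. of
  Math. (2) 197 (2023), 897–1113, doi:10.4007/annals.2023.197.3.2, Thm. 6.1.1, Def. 4.3.1,
  Def. 6.2.28 (held: arXiv:1812.09999, p0064 read 2026-08-16).
* [HarrisLanTaylorThorneRMS2016] M. Harris, K.-W. Lan, R. Taylor, J. Thorne, *On the rigid
  cohomology of certain Shimura varieties*, Res. Math. Sci. 3:37 (2016), Thm. A (`r_{p,ι}(π)`).
* [Clozel1990] L. Clozel, *Motifs et formes automorphes*, Perspect. Math. 10 (1990), §3.5,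
  Lemme 3.14 (weight zero).
-/

noncomputable section

open scoped MatrixGroups NumberField Classical
open NumberField IsDedekindDomain Field Filter
open Literature.NumberTheory.GaloisRepresentations Literature.NumberTheory.PAdicHodge

namespace Literature.NumberTheory.Automorphic

namespace ACCGHLNSTT2023

/-- **ACC+ 2023, Theorem 6.1.1, weight zero** (Fontaine–Laffaille automorphy lifting for `GL_n`
over an imaginary CM or totally real field, specialised to weight `λ = 0`), NAMED FACT.  For every
number field `F` which is totally real or (imaginary) CM, every `n`, every prime `p` with
`n² < p` and `2n < p` (the weight inequality (5a) at `λ = 0`), unramified in `F`, every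
`ι : ℚ̄_p ≃ ℂ` and every continuous `ρ : Γ_F → GL_n(ℚ̄_p)` such that: (1) `ρ` is unramified at
all but finitely many finite places; (2) for every `v ∣ p`, `ρ|_{Γ_{F_v}}` is crystalline relative
to the pinned Fontaine datum of `F_v` and, for every `ℚ_p`-embedding `τ' : F_v → ℚ̄_p`,
`HT_{τ'}(ρ) = {0, 1, …, n − 1}` (the weight-zero case of (5b)); (3)–(5) some residual
representation `τ : Γ_F → GL_n(ℤ̄_p/𝔪)` of `ρ` is absolutely irreducible and decomposed generic
(Def. 4.3.1), `τ|_{Γ_{F(ζ_p)}}` is absolutely irreducible with enormous image (Def. 6.2.28),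
`τ σ` is scalar for some `σ ∈ Γ_F ∖ Γ_{F(ζ_p)}`, and there are a cuspidal automorphic
representation `π` of `GL_n(𝔸_F)` of weight zero, unramified at every `v ∣ p`, and a framed
`r : Γ_F → GL_n(ℚ̄_p)` with HLTT's characterising property of `r_ι(π)` (hence `r^{ss} ≅ r_ι(π)`)
whose residual representation is `τ` (i.e. `ρ̄ ≅ \overline{r_ι(π)}`) — THEN `ρ` is automorphic
of weight zero: there is a cuspidal automorphic representation `Π` of `GL_n(𝔸_F)` of weight zero
such that `ρ` has the characterising property of `r_ι(Π)` (`ρ ≅ r_ι(Π)`), `Π_v` is unramified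
at every `v ∣ p`, and `Π_v` is unramified wherever both `ρ` and `π` are.  Grounds
`Summit.Langlands.Langlands.Theses.RamifiedCoefficientSeed.AdjointLiftingGL3` (`F = ℚ`, `n = 3`:
the item is this fact ∘ residual automorphy of `η ⊗ ad⁰(ρ₀)` in weight `0` (Serre–Khare–Wintenberger +
Gelbart–Jacquet) ∘ enormous/decomposed-generic image lemmas for `ad⁰`-type images).
[cite: ACCGHLNSTT2023, Thm. 6.1.1 (with Def. 4.3.1, Def. 6.2.28), weight λ = 0] -/
def automorphyLifting_crystalline_weightZero : Prop :=
  ∀ (F : Type) [Field F] [NumberField F], IsTotallyReal F ∨ IsCMField F →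
    ∀ (n : ℕ) (hcpt : isCompact_glFiniteIntegralLevel n F) (p : ℕ) [Fact p.Prime],
      -- (4, second clause) `p > n²`; (5a) at weight zero: `0 < p - 2n`
      n ^ 2 < p → 2 * n < p →
      -- (2, second clause) `p` is unramified in `F`
      Algebra.IsUnramifiedIn (𝓞 F) (Ideal.span {(p : ℤ)}) →
    ∀ (ι : PadicAlgCl p ≃+* ℂ) (ρ : FramedGaloisRep F (PadicAlgCl p) n)
      (τ : absoluteGaloisGroup F →* GL (Fin n) (padicAlgClResidueField p))
      (π : CuspidalAutomorphicRepData n F hcpt) (r : FramedGaloisRep F (PadicAlgCl p) n),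
      -- (1) unramified almost everywhere
      (∀ᶠ v : HeightOneSpectrum (𝓞 F) in cofinite, ρ.IsUnramifiedAt v) →
      -- (2) crystalline at `v ∣ p`, and (5b) Hodge–Tate weights `{n-1, …, 0}` for every label
      (∀ (v : HeightOneSpectrum (𝓞 F)) (hv : ((p : ℕ) : 𝓞 F) ∈ v.asIdeal),
        let D := fontainePstAdicCompletion v p hv
        D.IsCrystallineFramed (ρ.toLocal v) ∧
          (letI := D.algebra
           ∀ τ' : v.adicCompletion F →ₐ[ℚ_[p]] PadicAlgCl p,
             ρ.labelledHodgeTateWeightsAt v D.algebra D.𝔅 τ'.toRingHom =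
               (Multiset.range n).map fun i : ℕ => (i : ℤ))) →
      -- (3), (4): `τ` is a residual representation `ρ̄` of `ρ`; absolutely irreducible,
      -- decomposed generic, `ρ̄(Γ_{F(ζ_p)})` absolutely irreducible and enormous, a scalar
      -- `ρ̄(σ)` for some `σ ∉ Γ_{F(ζ_p)}`
      ρ.IsResidualRepOf (RingHom.id _) τ → IsAbsIrreducible τ → IsDecomposedGeneric τ →
      IsAbsIrreducible (τ.comp (absGaloisGroupAdjoinRootsOfUnity F p).subtype) →
      Subgroup.IsEnormous ((absGaloisGroupAdjoinRootsOfUnity F p).map τ) →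
      (∃ σ : absoluteGaloisGroup F, σ ∉ absGaloisGroupAdjoinRootsOfUnity F p ∧
        ∃ c : padicAlgClResidueField p,
          ((τ σ : GL (Fin n) (padicAlgClResidueField p)) :
            Matrix (Fin n) (Fin n) (padicAlgClResidueField p)) = c • (1 : Matrix _ _ _)) →
      -- (5): `π` cuspidal of weight zero, unramified at `v ∣ p`, and `ρ̄ ≅ r̄_ι(π)`: `r` has the
      -- characterising property of `r_ι(π)` and residual representation `τ`
      π.1.HasWeightZero → HLTT.IsCompatible π.1 ι r →
      r.IsResidualRepOf (RingHom.id _) τ →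
      (∀ v : HeightOneSpectrum (𝓞 F), ((p : ℕ) : 𝓞 F) ∈ v.asIdeal → π.1.IsUnramifiedAt v) →
      -- conclusion: `ρ ≅ r_ι(Π)` for a cuspidal `Π` of weight zero; `Π_v` unramified at `v ∣ p`
      -- and wherever both `ρ` and `π` are unramified
      ∃ Pi : CuspidalAutomorphicRepData n F hcpt,
        Pi.1.HasWeightZero ∧ HLTT.IsCompatible Pi.1 ι ρ ∧
          (∀ v : HeightOneSpectrum (𝓞 F), ((p : ℕ) : 𝓞 F) ∈ v.asIdeal → Pi.1.IsUnramifiedAt v) ∧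
          ∀ v : HeightOneSpectrum (𝓞 F), ρ.IsUnramifiedAt v → π.1.IsUnramifiedAt v →
            Pi.1.IsUnramifiedAt v

end ACCGHLNSTT2023

end Literature.NumberTheory.Automorphic
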